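import Summits.ValiantsHypothesis.ValiantsHypothesis.Theorems.DepthWindowNodeBiasBDS
import Summits.ValiantsHypothesis.ValiantsHypothesis.Theorems.DepthWindowBDSFit
import HarnessLib.Audit.Tags

/-!
# Route `DepthWindow` — the slope-one slice of `TreeBiasGrowth` holds; `UniversalLowBiasAt 1` is false

Cone-free helper (decomp-valiant workshop, lens 4 «depth-reduction / chasm axis», generation 14) supporting the
crux item `HomImmHardTwoOne` (stmt-ValiantsHypothesis-30635).  It lands the ADVERSARY's lower rung on the tree-bias
ladder of `DepthWindowNodeBias.lean` as kernel facts: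

* `treeBiasGrowthAt_one : TreeBiasGrowthAt 1` — in the regime `n = m³`, `d = ⌊√log₂ n⌋`, for every `c, C`,
  eventually in `m`, at EVERY depth `Δ ≤ log₂^{∘3} m + c + 1` some fitting positive word (the depth-tuned two-letter
  word of [BhargavDuttaSaxena2024, §4.1] with base `λ = (256C+64)(⌊7v/5⌋ + c + 1)`, `v = ⌊log₂ log₂ log₂ m⌋`, read
  through `BDS.exists_word_nodeBias_ge`) has `Treebias_Δ ≥ 2C(log₂^{∘3} m + c + 2)·log₂ m`;
* `not_universalLowBiasAt_one : ¬ UniversalLowBiasAt 1` (and `_zero`) — by the landed bridge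
  `not_ULB_of_treeBiasGrowthAt`: NO universal tree builder of depth `log₂ log₂ d + O(1)` and node bias `O(h)`
  exists.  Together with g13's `TreeBiasBridgeAt.lean` (`ULB_2 ⇒ ¬ TreeBiasGrowthAt (2u)`, `ULB_∞` builder side
  PROVED) the node's window is now pinned by kernel facts on both sides: the door `HomImmHardAt 2 u` needs slope
  `2u ≥ 2`; slope `1` is supplied unconditionally here; slope `2` is exactly the open `ULB_2` question
  ([LimayeSrinivasanTavenas2022, §1.3 / Prop. 17]: is `Treebias_Δ = O(h)` reachable at depth `2 log₂ log₂ d`?).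

Reading corrected (critic, bus line 648 (a)): the words refuting `ULB_1` are BDS's depth-tuned two-letter words
`{+(q-p)t, -qt}` (continued-fraction parameters, thresholds `λ^{F_i}`), whose node bias at depth `Δ` is
`Ω(h·d^{μ(Δ)})`, `μ(Δ) = 1/(F_{Δ+2}-1) ≈ φ^{-Δ}` — not LST's fixed golden-ratio words (bias `h·d^{2^{-Δ}}`, which is
`O(h)` already at depth `log₂ log₂ d + O(1)` and refutes nothing).  Unconditional, 0 sorry, definition-free; rung
currency only — nothing here bears on `VP ≠ VNP` itself.

References: [BhargavDuttaSaxena2024] ACM ToCT 16(4):23 (2024) §4.1, Lemma 4.3; [LimayeSrinivasanTavenas2022]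
ECCC TR22-090 / FOCS 2022, Def. 2, Def. 15, Prop. 17, §1.3; [LimayeSrinivasanTavenas2025] J. ACM 72 (2025) Art. 26,
Lemma 15, Claim 16.
-/

-- layout Summits/ValiantsHypothesis/ValiantsHypothesis forces the duplicated namespace component
set_option linter.dupNamespace false

namespace Summit.ValiantsHypothesis.ValiantsHypothesis.Theorems.DepthWindow.TreeBias

open Finset Literature.Computability.AlgebraicComplexity

noncomputable section

/-- **The slope-one slice of `TreeBiasGrowth` holds** (the adversary's rung): for all `c, C`, eventually in `m`,
every depth `Δ ≤ log₂^{∘3} m + c + 1` admits a fitting positive word on `⌊√log₂ m⌋` letters with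
`Treebias_Δ ≥ 2C(log₂^{∘3} m + c + 2)·log₂ m`.  Witness: the BDS two-letter word at base
`λ = (256C+64)(⌊7v/5⌋ + c + 1)` (fit `λ^{F_{Δ+2}} ≤ ⌊√log₂ m⌋` from `BDS.base_pow_fib_le_sqrt`), scale
`t = ⌊log₂ m / q⌋`, whose forced node bias `qt·λ/32 ≥ (log₂ m)·λ/64` beats `τ + |Sum| ≤ τ + qt`.
[cite: BhargavDuttaSaxena2024, Lemma 4.3] [cite: LimayeSrinivasanTavenas2022, Prop. 17] -/
theorem treeBiasGrowthAt_one : TreeBiasGrowthAt 1 := by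
  intro c C
  obtain ⟨L₀, hL₀⟩ := BDS.base_pow_fib_le_sqrt (256 * C + 64) (c + 1)
  refine ⟨2 ^ max L₀ 16, fun m hm Δ hΔ => ?_⟩
  -- the scales `L = ⌊log₂ m⌋ ≥ max L₀ 16`, `d = ⌊√L⌋ ≥ 4`, `v = ⌊log₂ log₂ L⌋`
  have hm0 : m ≠ 0 := by
    have : 1 ≤ 2 ^ max L₀ 16 := Nat.one_le_two_pow
    omega
  have hLm : 2 ^ Nat.log 2 m ≤ m := Nat.pow_log_le_self 2 hm0
  have hLge : max L₀ 16 ≤ Nat.log 2 m := Nat.le_log_of_pow_le (by norm_num) hm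
  generalize Nat.log 2 m = L at hLm hLge hΔ ⊢
  have hfib := hL₀ L (le_of_max_le_left hLge)
  have hL16 : 16 ≤ L := le_of_max_le_right hLge
  have h4d : 4 ≤ Nat.sqrt L := Nat.le_sqrt.2 (by omega)
  have hdL : Nat.sqrt L * Nat.sqrt L ≤ L := Nat.sqrt_le L
  generalize Nat.sqrt L = d at hfib h4d hdL ⊢
  generalize Nat.log 2 (Nat.log 2 L) = v at hfib hΔ ⊢
  have h4dL : 4 * d ≤ L := (Nat.mul_le_mul_right d h4d).trans hdL
  -- the base `λ = (256C+64)(⌊7v/5⌋ + c + 1) ≥ 3` and its fit at depth `max Δ 1`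
  have hlam3 : 3 ≤ (256 * C + 64) * (7 * v / 5 + (c + 1)) :=
    le_trans (by omega) (Nat.le_mul_of_pos_right _ (by omega))
  have hΔ1 : max Δ 1 ≤ 7 * v / 5 + (c + 1) := max_le (by omega) (by omega)
  have hfit : ((256 * C + 64) * (7 * v / 5 + (c + 1))) ^ Nat.fib (max Δ 1 + 2) ≤
      (256 * C + 64) * (7 * v / 5 + (c + 1)) * d :=
    calc ((256 * C + 64) * (7 * v / 5 + (c + 1))) ^ Nat.fib (max Δ 1 + 2)
        ≤ ((256 * C + 64) * (7 * v / 5 + (c + 1))) ^ Nat.fib (7 * v / 5 + (c + 1) + 2) :=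
          Nat.pow_le_pow_right (by omega) (Nat.fib_mono (by omega))
      _ ≤ d := hfib
      _ ≤ (256 * C + 64) * (7 * v / 5 + (c + 1)) * d := Nat.le_mul_of_pos_left d (by omega)
  -- the linear comparison `128C(v+c+2) + 32 ≤ λ`
  have hB : ((128 * C * (1 * v + c + 2) + 32 : ℕ) : ℝ) ≤
      (((256 * C + 64) * (7 * v / 5 + (c + 1)) : ℕ) : ℝ) := by
    have hx : ((1 * v + c + 1 : ℕ) : ℝ) ≤ ((7 * v / 5 + (c + 1) : ℕ) : ℝ) := by
      exact_mod_cast (show 1 * v + c + 1 ≤ 7 * v / 5 + (c + 1) by omega)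
    have h1 := mul_le_mul_of_nonneg_left hx (by positivity : (0 : ℝ) ≤ ((256 * C + 64 : ℕ) : ℝ))
    have hCv : (0 : ℝ) ≤ (C : ℝ) * v := by positivity
    have hCc : (0 : ℝ) ≤ (C : ℝ) * c := by positivity
    have hv0 : (0 : ℝ) ≤ v := Nat.cast_nonneg _
    have hc0 : (0 : ℝ) ≤ c := Nat.cast_nonneg _
    push_cast at h1 ⊢
    linarith
  -- the BDS word at depth `max Δ 1`
  obtain ⟨p, q, hp1, hpq, hq2d, hw⟩ := BDS.exists_word_nodeBias_ge (le_max_right Δ 1) hlam3 hfit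
  -- the scale `t = ⌊L/q⌋ ≥ 1`, with `L ≤ 2qt` and `qt ≤ L`
  have hq0 : 0 < q := by omega
  have hqL : q ≤ L := by omega
  have ht0 : 0 < L / q := Nat.div_pos hqL hq0
  have hdm : q * (L / q) + L % q = L := Nat.div_add_mod L q
  have hmod : L % q < q := Nat.mod_lt L hq0
  generalize L / q = t at ht0 hdm
  have htL : q * t ≤ L := by omega
  have hqt2 : L ≤ 2 * (q * t) := by omega
  have hkp : 0 < (q - p) * t := Nat.mul_pos (by omega) ht0
  have hkn : 0 < q * t := Nat.mul_pos hq0 ht0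
  obtain ⟨hover, -, hsum, hT⟩ := hw t
  generalize GenWord.greedyWord₂ d ((q - p) * t) (q * t) = pos at hover hsum hT
  generalize hsz : GenWord.letterSize₂ ((q - p) * t) (q * t) pos = sz at hover hsum hT
  refine ⟨sz, pos, fun i => ?_, fun t' _ => ?_, ?_⟩
  · -- positive letters
    rw [← hsz]
    unfold GenWord.letterSize₂
    split <;> omega
  · -- the fit `2^{overLen} ≤ 2^{qt} ≤ 2^L ≤ m`
    exact (Nat.pow_le_pow_right (by norm_num) ((hover t').trans htL)).trans hLm
  · -- the tree bias
    rcases Nat.eq_zero_or_pos Δ with rfl | hΔpos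
    · -- depth `0`: no tree on `d ≥ 2` leaves has a single block at level `0`
      intro T hroot
      exact absurd (hroot ⟨0, by omega⟩ ⟨1, by omega⟩) (by simp [T.leaf])
    · have hΔ1le : 1 ≤ Δ := hΔpos
      rw [max_eq_left hΔ1le] at hT
      refine treeBiasGe_of_nodeBias fun T hroot => ?_
      obtain ⟨u, i, hu1, huΔ, hE⟩ := hT T hroot
      refine ⟨u, i, hu1, huΔ, ?_⟩
      -- `τ + qt ≤ qt·λ/32` from `L ≤ 2qt` and `128C(v+c+2) + 32 ≤ λ`
      have key : ((2 * (C * (1 * v + c + 2) * L) : ℕ) : ℝ) + ((q * t : ℕ) : ℝ) ≤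
          ((q * t : ℕ) : ℝ) * (((256 * C + 64) * (7 * v / 5 + (c + 1)) : ℕ) : ℝ) / 32 := by
        have hA : (L : ℝ) ≤ 2 * ((q * t : ℕ) : ℝ) := by exact_mod_cast hqt2
        have hC' := mul_le_mul_of_nonneg_left hA
          (by positivity : (0 : ℝ) ≤ (C : ℝ) * ((1 * v + c + 2 : ℕ) : ℝ))
        have hD' := mul_le_mul_of_nonneg_right hB (by positivity : (0 : ℝ) ≤ ((q * t : ℕ) : ℝ))
        push_cast at hC' hD' ⊢
        linarith
      have hR : ((2 * (C * (1 * v + c + 2) * L) : ℕ) : ℝ) + ((|∑ j, GenWord.wt sz pos j| : ℤ) : ℝ) ≤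
          ((nodeBias (GenWord.wt sz pos) T u i : ℤ) : ℝ) := by
        have h2 : ((|∑ j, GenWord.wt sz pos j| : ℤ) : ℝ) ≤ ((q * t : ℕ) : ℝ) := by exact_mod_cast hsum
        linarith
      exact_mod_cast hR

/-- Hence also the slope-zero slice (depths `Δ ≤ c + 1`, thresholds `2C(c+2)·log₂ m`). [folklore] -/
theorem treeBiasGrowthAt_zero : TreeBiasGrowthAt 0 := by
  intro c C
  obtain ⟨m₀, h⟩ := treeBiasGrowthAt_one c C
  refine ⟨m₀, fun m hm Δ hΔ => ?_⟩
  obtain ⟨sz, pos, h1, h2, h3⟩ := h m hm Δ (by omega)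
  refine ⟨sz, pos, h1, h2, h3.mono (Nat.mul_le_mul_left 2 (Nat.mul_le_mul_right _ ?_))⟩
  exact Nat.mul_le_mul_left C (by omega)

/-- **`UniversalLowBiasAt 1` is false**: there is NO universal tree builder giving every integer word with
letters and total in `[-h, h]` a tree of depth `log₂ log₂ d + O(1)` and node bias `O(h)` — the BDS words beat it
(kernel: `treeBiasGrowthAt_one` + the landed bridge `not_ULB_of_treeBiasGrowthAt`).  The door of the node needs
slope `2u ≥ 2` (`TreeBiasBridgeAt.lean`, g13); slope `2` = `ULB_2` is the open question of
[LimayeSrinivasanTavenas2022, §1.3]. [cite: LimayeSrinivasanTavenas2022, Prop. 17]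
[cite: BhargavDuttaSaxena2024, Lemma 4.3] -/
theorem not_universalLowBiasAt_one : ¬ UniversalLowBiasAt 1 :=
  not_ULB_of_treeBiasGrowthAt le_rfl treeBiasGrowthAt_one

/-- … and a fortiori `UniversalLowBiasAt 0` (depth `O(1)`, node bias `O(h)`) is false.
[cite: LimayeSrinivasanTavenas2022, Prop. 17] -/
theorem not_universalLowBiasAt_zero : ¬ UniversalLowBiasAt 0 :=
  not_ULB_of_treeBiasGrowthAt (Nat.zero_le 1) treeBiasGrowthAt_one

end

end Summit.ValiantsHypothesis.ValiantsHypothesis.Theorems.DepthWindow.TreeBias
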